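import Literature.Probability.Percolation.SmirnovReflection
import Literature.Probability.Percolation.CardyFormula
import Literature.Probability.Percolation.LatticeSymmetry
import Literature.Probability.RandomPlanarGeometry.HullApproximation
import HarnessLib

/-!
# Route CardyBondTriangular · crux `BondTriangularCardy` (stmt-CriticalPhenomena-4664), line `birth`:
# the reflection `ρ z = -z̄` on Carleson data, lattice contours and the crude bond-𝕋 crossing probability

Helper file of the stub `stub_ofAnticlockwise` (anticlockwise Carleson data suffice for critical
bond percolation on the triangular lattice `𝕋`). The tree's PROVED site-𝕋 reduction
`Literature.Probability.Percolation.smirnov_exists_separatingData_of_anticlockwise`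
(`SmirnovReflection.lean`) passes from a clockwise Carleson datum of `R` to the anticlockwise
datum of the complex conjugate rectangle `R*`, using that `conj` preserves `δ𝕋` and `P_{1/2}`.
For the route's bond model the crossing probability is that of the EMBEDDED bond lattice
`L = √3 (𝕋 − (1+ζ)/3)` (`embDomainCrossing` with `z x = √3 (triEmbed x − (1+ζ)/3)`), which is
not `conj`-invariant (conjugation exchanges up- and down-triangle centroids) but is invariant
under the reflection in the imaginary axis `ρ z = -z̄`
(`Literature.Probability.RandomPlanarGeometry.imagAxisRefl`): the site relabelling
`σ (x₀, x₁) = (1 - x₀ - x₁, x₁) = triConjFun (-x) + e₀` is an automorphism of `𝕋` with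
`z (σ x) = ρ (z x)`. This file records the elementary `ρ`-lemmas the stub needs:

* `ρ` on equilateral triangles, open segments, the turn `(c - b)/(b - a)` (conjugated) and on
  boundary values of the reflected conformal map `ρ ∘ ψ ∘ ρ` (`ConformalEquiv.reflect`);
* the discrete contour integral of Bollobás–Riordan (pp. 180–181) under `z ↦ -z`
  (`discreteTriangleIntegral_comp_neg`, the registered helper signature) and under `ρ`
  (`discreteTriangleIntegral_comp_imagAxisRefl`: `∮ᴰ_C (F ∘ ρ) dz = conj ∮ᴰ_{C'} F dz` for the
  reflected lattice contour `C'` with corner `ρ p − n s` and the SAME signed mesh), face centres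
  and solid lattice triangles under `ρ`;
* `bondTriangular_real_embDomainCrossing_imagAxisRefl`: the crude crossing probabilities of
  `(ρ Ω; ρ A, ρ B)` and `(Ω; A, B)` for bond percolation on `𝕋` (any parameter) agree, by the
  isomorphism invariance of `P_p` (`bondPercolation_real_image`) applied to `σ`.

References: B. Bollobás, O. Riordan, *Percolation*, CUP 2006, Ch. 7 §7.2.2 pp. 168–169
(anticlockwise conventions), pp. 180–181 (discrete contour integral), Lemma 13 p. 181;
G. Grimmett, *Percolation*, 2nd ed. 1999, §1.6 (lattice symmetries of `P_p`).
-/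

noncomputable section

namespace Summit.CriticalPhenomena.CardyFormulaZ2.Theorems.BondTriangularCardyLine

open Set Filter Topology Metric Complex
open scoped ComplexConjugate
open Literature.Probability.Percolation Literature.Probability.RandomPlanarGeometry
open Literature.Probability.LatticeModels

/-! ### The reflection `ρ z = -z̄` on sets, triangles, segments and turns -/

/-- `ρ` commutes with real scalars: `ρ (δ w) = δ ρ(w)`. [folklore] -/
theorem imagAxisRefl_ofReal_mul (δ : ℝ) (w : ℂ) :
    imagAxisRefl ((δ : ℂ) * w) = (δ : ℂ) * imagAxisRefl w := by
  simp only [imagAxisRefl_apply, map_mul, Complex.conj_ofReal]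
  ring

/-- Membership in a reflected set: `w ∈ ρ(T) ↔ ρ w ∈ T` (`ρ` is an involution). [folklore] -/
theorem mem_image_imagAxisRefl_iff (w : ℂ) (T : Set ℂ) :
    w ∈ imagAxisRefl '' T ↔ imagAxisRefl w ∈ T := by
  rw [← imagAxisRefl_preimage]; rfl

/-- `ρ` is an isometry of the plane. [folklore] -/
theorem isometry_imagAxisRefl : Isometry imagAxisRefl :=
  Isometry.of_dist_eq dist_imagAxisRefl

/-- Distances to reflected sets: `d(w, ρ T) = d(ρ w, T)`. [folklore] -/
theorem infDist_image_imagAxisRefl (w : ℂ) (T : Set ℂ) :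
    infDist w (imagAxisRefl '' T) = infDist (imagAxisRefl w) T := by
  conv_lhs => rw [← imagAxisRefl_imagAxisRefl w]
  exact Metric.infDist_image isometry_imagAxisRefl

/-- `ρ` is real-linear, so it maps convex hulls to convex hulls. [folklore] -/
theorem image_imagAxisRefl_convexHull (s : Set ℂ) :
    imagAxisRefl '' convexHull ℝ s = convexHull ℝ (imagAxisRefl '' s) := by
  have h := (-(conjLIE.toLinearEquiv.toLinearMap : ℂ →ₗ[ℝ] ℂ)).image_convexHull s
  have hcoe : ((-(conjLIE.toLinearEquiv.toLinearMap : ℂ →ₗ[ℝ] ℂ) : ℂ →ₗ[ℝ] ℂ) : ℂ → ℂ) =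
      imagAxisRefl := by
    funext z
    simp [conjLIE_apply]
  rw [hcoe] at h
  exact h

/-- The reflection of the open triangle is the open triangle of the reflected vertices.
[folklore] -/
theorem imagAxisRefl_image_openTriangle (a b c : ℂ) :
    imagAxisRefl '' openTriangle a b c =
      openTriangle (imagAxisRefl a) (imagAxisRefl b) (imagAxisRefl c) := by
  rw [openTriangle, openTriangle, imagAxisRefl.image_interior, image_imagAxisRefl_convexHull,
    image_insert_eq, image_insert_eq, image_singleton]

/-- Equilateral triangles are preserved by the isometry `ρ`. [folklore] -/
theorem isEquilateral_imagAxisRefl {a b c : ℂ} (h : IsEquilateral a b c) :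
    IsEquilateral (imagAxisRefl a) (imagAxisRefl b) (imagAxisRefl c) := by
  obtain ⟨h1, h2, h3⟩ := h
  refine ⟨?_, ?_, ?_⟩
  · rw [dist_imagAxisRefl, dist_imagAxisRefl]; exact h1
  · rw [dist_imagAxisRefl, dist_imagAxisRefl]; exact h2
  · intro h; exact h3 (imagAxisRefl.injective h)

/-- Open segments are preserved by the real-linear map `ρ`. [folklore] -/
theorem mem_openSegment_imagAxisRefl {c a d : ℂ} (h : d ∈ openSegment ℝ c a) :
    imagAxisRefl d ∈ openSegment ℝ (imagAxisRefl c) (imagAxisRefl a) := by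
  obtain ⟨u, v, hu, hv, huv, rfl⟩ := h
  refine ⟨u, v, hu, hv, huv, ?_⟩
  simp only [imagAxisRefl_apply, Complex.real_smul, map_add, map_mul, Complex.conj_ofReal]
  ring

/-- The turn of the reflected triangle is the conjugate turn (`z ↦ -z` does not change
`(c - b)/(b - a)`, conjugation conjugates it): a clockwise datum becomes anticlockwise.
[folklore] -/
theorem triangleTurn_imagAxisRefl (a b c : ℂ) :
    triangleTurn (imagAxisRefl a) (imagAxisRefl b) (imagAxisRefl c) = conj (triangleTurn a b c) := by
  simp only [triangleTurn, imagAxisRefl_apply, map_div₀, map_sub]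
  rw [show -conj c - -conj b = -(conj c - conj b) by ring,
    show -conj b - -conj a = -(conj b - conj a) by ring, neg_div_neg_eq]

/-- Boundary values of the reflected conformal map `ρ ∘ φ ∘ ρ : ρ(U) → ρ(V)`: if `φ z → p` as
`z → x` within `U`, then `ρ φ ρ z → ρ p` as `z → ρ x` within `ρ(U)`. [folklore] -/
theorem hasBoundaryValue_reflect {U V : Set ℂ} {φ : ConformalEquiv U V} (hU : IsOpen U)
    (hV : IsOpen V) {x p : ℂ} (h : φ.HasBoundaryValue x p) :
    (φ.reflect hU hV).HasBoundaryValue (imagAxisRefl x) (imagAxisRefl p) := by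
  unfold ConformalEquiv.HasBoundaryValue at h ⊢
  have h1 : Tendsto imagAxisRefl (𝓝[imagAxisRefl '' U] (imagAxisRefl x)) (𝓝[U] x) := by
    have hc : ContinuousWithinAt imagAxisRefl (imagAxisRefl '' U) (imagAxisRefl x) :=
      imagAxisRefl.continuous.continuousWithinAt
    have := hc.tendsto_nhdsWithin (fun z hz => (mem_image_imagAxisRefl_iff z U).1 hz)
    simpa using this
  exact (imagAxisRefl.continuous.tendsto p).comp (h.comp h1)

/-! ### The discrete contour integral under `z ↦ -z` and under `ρ` -/

/-- The integrand points of the point-reflected contour (corner `-p`, signed mesh `-s`) are the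
negatives of those of the contour `(p, s)`. [folklore] -/
theorem latticeEdgeCentre_neg (p : ℂ) (s : ℝ) (n : ℕ) (k : Fin 3) (j : ℕ) :
    latticeEdgeCentre (-p) (-s) n k j = -latticeEdgeCentre p s n k j := by
  fin_cases k <;> simp [latticeEdgeCentre, latticeCorner] <;> ring

/-- **The discrete contour integral under the point reflection `z ↦ -z`** (registered helper
signature of this file): `∮ᴰ_C (F ∘ neg) dz = - ∮ᴰ_{-C} F dz`, where `-C` is the lattice
contour with corner `-p` and signed mesh `-s` (same orientation, `dz ↦ -dz`; Bollobás–Riordan's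
face-centre sum, pp. 180–181). [folklore] -/
theorem discreteTriangleIntegral_comp_neg :
    ∀ (F : ℂ → ℝ) (p : ℂ) (s : ℝ) (n : ℕ), Literature.Probability.Percolation.discreteTriangleIntegral (fun z => F (-z)) p s n = -Literature.Probability.Percolation.discreteTriangleIntegral F (-p) (-s) n := by
  intro F p s n
  unfold discreteTriangleIntegral
  rw [← Finset.sum_neg_distrib]
  refine Finset.sum_congr rfl fun k _ => ?_
  rw [← Finset.sum_neg_distrib]
  refine Finset.sum_congr rfl fun j _ => ?_
  rw [latticeEdgeCentre_neg]
  beta_reduce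
  push_cast
  ring

/-- **The discrete contour integral under `ρ`**: `∮ᴰ_C (F ∘ ρ) dz = conj ∮ᴰ_{C'} F dz` for the
reflected lattice contour `C'` with corner `ρ p − n s`, the same signed mesh `s` and `n` steps
(from `discreteTriangleIntegral_comp_conj` and `discreteTriangleIntegral_comp_neg`). [folklore] -/
theorem discreteTriangleIntegral_comp_imagAxisRefl (F : ℂ → ℝ) (p : ℂ) (s : ℝ) (n : ℕ) :
    discreteTriangleIntegral (fun z => F (imagAxisRefl z)) p s n =
      conj (discreteTriangleIntegral F (imagAxisRefl p - n * s) s n) := by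
  have h2 := discreteTriangleIntegral_comp_conj p s n (fun w => F (-w))
  have h3 := discreteTriangleIntegral_comp_neg F (conj p + n * s) (-s) n
  beta_reduce at h2
  simp only [imagAxisRefl_apply]
  rw [h2, h3, neg_neg, map_neg, neg_neg]
  congr 2
  ring

/-- The negative of a face centre is a face centre (`-centre(x, up) = centre(-x-e₀-e₁, down)`,
`-centre(x, down) = centre(-x-e₀-e₁, up)`). [folklore] -/
theorem exists_hexCenter_eq_neg (x : HexVertex) :
    ∃ x' : HexVertex, hexCenter x' = -hexCenter x := by
  rcases x with ⟨y, t⟩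
  by_cases ht : t = 0
  · subst ht
    refine ⟨(-y - Pi.single 0 1 - Pi.single 1 1, 1), ?_⟩
    simp only [hexCenter, triEmbed_sub, triEmbed_neg, triEmbed_single_one, triEmbed_single_zero,
      Fin.isValue, Fin.val_one, Nat.cast_one, Fin.val_zero, CharP.cast_eq_zero, zero_add]
    ring
  · obtain rfl : t = 1 := by
      rcases Fin.exists_fin_two.1 ⟨t, rfl⟩ with h' | h'
      · exact (ht h').elim
      · exact h'
    refine ⟨(-y - Pi.single 0 1 - Pi.single 1 1, 0), ?_⟩
    simp only [hexCenter, triEmbed_sub, triEmbed_neg, triEmbed_single_one, triEmbed_single_zero,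
      Fin.isValue, Fin.val_one, Nat.cast_one, Fin.val_zero, CharP.cast_eq_zero, zero_add]
    ring

/-- The reflection `ρ` of a face centre is a face centre. [folklore] -/
theorem exists_hexCenter_eq_imagAxisRefl (x : HexVertex) :
    ∃ x' : HexVertex, hexCenter x' = imagAxisRefl (hexCenter x) := by
  obtain ⟨x₁, h₁⟩ := exists_hexCenter_eq_conj x
  obtain ⟨x₂, h₂⟩ := exists_hexCenter_eq_neg x₁
  exact ⟨x₂, by rw [h₂, h₁, imagAxisRefl_apply]⟩

/-- The reflection of the solid lattice triangle `conv{p, p + ns, p + nsζ}` is the solid lattice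
triangle `conv{q, q + ns, q + nsζ}` with `q = ρ p − n s` (`ρ(p) = q + ns`, `ρ(p + ns) = q`,
`ρ(p + nsζ) = q + nsζ` as `ρ ζ = ζ - 1`). [folklore] -/
theorem imagAxisRefl_image_convexHull_latticeTriangle (p : ℂ) (s : ℝ) (n : ℕ) :
    imagAxisRefl '' convexHull ℝ ({p, p + n * s, p + n * s * triZeta} : Set ℂ) =
      convexHull ℝ ({imagAxisRefl p - n * s, imagAxisRefl p - n * s + n * s,
        imagAxisRefl p - n * s + n * s * triZeta} : Set ℂ) := by
  rw [image_imagAxisRefl_convexHull, image_insert_eq, image_insert_eq, image_singleton]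
  congr 1
  have e1 : imagAxisRefl p - n * s + n * s = imagAxisRefl p := by ring
  have e2 : imagAxisRefl (p + n * s) = imagAxisRefl p - n * s := by
    simp only [imagAxisRefl_apply, map_add, map_mul, map_natCast, Complex.conj_ofReal]
    ring
  have e3 : imagAxisRefl (p + n * s * triZeta) = imagAxisRefl p - n * s + n * s * triZeta := by
    simp only [imagAxisRefl_apply, map_add, map_mul, map_natCast, Complex.conj_ofReal, conj_triZeta]
    ring
  rw [e1, e2, e3]
  ext z
  simp only [mem_insert_iff, mem_singleton_iff]
  tauto

/-! ### The embedded bond lattice `√3 (𝕋 − (1+ζ)/3)` is `ρ`-invariant -/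

/-- The site relabelling `σ x = triConjFun (-x) + e₀ = (1 - x₀ - x₁, x₁)` realises `ρ` up to
the translation by `1`: `triEmbed (σ x) = ρ (triEmbed x) + 1`. [folklore] -/
theorem triEmbed_reflSite (x : Site 2) :
    triEmbed (triConjFun (-x) + ![1, 0]) = imagAxisRefl (triEmbed x) + 1 := by
  rw [triEmbed_add, triEmbed_triConjFun, triEmbed_neg, triEmbed_vec, map_neg, imagAxisRefl_apply]
  push_cast
  ring

/-- **The route's embedding is `ρ`-equivariant**: `z (σ x) = ρ (z x)` for
`z x = √3 (triEmbed x − (1+ζ)/3)` (the up-triangle centroid `(1+ζ)/3` has real part `1/2`).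
[folklore] -/
theorem embed_reflSite (x : Site 2) :
    (Real.sqrt 3 : ℂ) * (triEmbed (triConjFun (-x) + ![1, 0]) - (1 + triZeta) / 3) =
      imagAxisRefl ((Real.sqrt 3 : ℂ) * (triEmbed x - (1 + triZeta) / 3)) := by
  rw [triEmbed_reflSite]
  have h3 : conj (3 : ℂ) = 3 := map_ofNat _ 3
  simp only [imagAxisRefl_apply, map_mul, map_sub, map_div₀, map_add, map_one,
    Complex.conj_ofReal, conj_triZeta, h3]
  ring

/-- `σ` is an involution of `ℤ²`. [folklore] -/
theorem involutive_reflSite : Function.Involutive (fun x : Site 2 => triConjFun (-x) + ![1, 0]) := by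
  intro x
  show triConjFun (-(triConjFun (-x) + ![1, 0])) + ![1, 0] = x
  ext i
  fin_cases i
  · simp [triConjFun]; ring
  · simp [triConjFun]

/-- `σ` is an automorphism of `𝕋` (it is an isometry of the embedded lattice). [folklore] -/
theorem triGraph_adj_reflSite_iff (x y : Site 2) :
    triGraph.Adj (triConjFun (-x) + ![1, 0]) (triConjFun (-y) + ![1, 0]) ↔
      triGraph.Adj x y := by
  rw [triGraph_adj_iff_dist_holds, triGraph_adj_iff_dist_holds, triEmbed_reflSite,
    triEmbed_reflSite, add_sub_add_right_eq_sub, ← dist_eq_norm, dist_imagAxisRefl, dist_eq_norm]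

/-- **The crude crossing probability of bond-𝕋 is `ρ`-invariant**: for bond percolation on `𝕋`
with any parameter `p` and the embedding `z x = √3 (triEmbed x − (1+ζ)/3)`, the crossing
events `embDomainCrossing z (ρ Ω) δ (ρ A) (ρ B)` and `embDomainCrossing z Ω δ A B` have the same
probability: the former is the relabelling along the automorphism `σ` of the latter
(`z (σ x) = ρ (z x)`, `ρ` an isometry), and `P_p` is invariant under graph automorphisms
(`bondPercolation_real_image`; Grimmett 1999 §1.6). [folklore] -/
theorem bondTriangular_real_embDomainCrossing_imagAxisRefl (p : unitInterval) (Ω A B : Set ℂ)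
    (δ : ℝ) :
    (bondPercolation triGraph p).real (embDomainCrossing
        (fun x : Site 2 => (Real.sqrt 3 : ℂ) * (triEmbed x - (1 + triZeta) / 3))
        (imagAxisRefl '' Ω) δ (imagAxisRefl '' A) (imagAxisRefl '' B)) =
      (bondPercolation triGraph p).real (embDomainCrossing
        (fun x : Site 2 => (Real.sqrt 3 : ℂ) * (triEmbed x - (1 + triZeta) / 3)) Ω δ A B) := by
  -- the automorphism `σ` of `𝕋`
  let σ : Site 2 ≃ Site 2 := Function.Involutive.toPerm _ involutive_reflSite
  let φ : triGraph ≃g triGraph :=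
    { toEquiv := σ, map_rel_iff' := fun {a b} => triGraph_adj_reflSite_iff a b }
  have hφ : ∀ x, φ x = triConjFun (-x) + ![1, 0] := fun x => rfl
  have hφφ : ∀ x, φ (φ x) = x := fun x => by
    rw [hφ, hφ]; exact involutive_reflSite x
  have hρz : ∀ y : Site 2,
      imagAxisRefl ((δ : ℂ) * ((Real.sqrt 3 : ℂ) * (triEmbed y - (1 + triZeta) / 3))) =
        (δ : ℂ) * ((Real.sqrt 3 : ℂ) * (triEmbed (φ y) - (1 + triZeta) / 3)) := fun y => by
    rw [imagAxisRefl_ofReal_mul, hφ, embed_reflSite]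
  have himage : ∀ S : Set (Site 2), φ '' S = {y | φ y ∈ S} := fun S => by
    ext y
    constructor
    · rintro ⟨w, hw, rfl⟩
      show φ (φ w) ∈ S
      rw [hφφ]; exact hw
    · intro hy
      exact ⟨φ y, hy, hφφ y⟩
  have h1 : {y : Site 2 | (δ : ℂ) * ((Real.sqrt 3 : ℂ) * (triEmbed y - (1 + triZeta) / 3)) ∈
      imagAxisRefl '' Ω} =
      φ '' {y : Site 2 | (δ : ℂ) * ((Real.sqrt 3 : ℂ) * (triEmbed y - (1 + triZeta) / 3)) ∈ Ω} := by
    rw [himage]; ext y; simp only [mem_setOf_eq]; rw [mem_image_imagAxisRefl_iff, hρz]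
  have h2 : ∀ T : Set ℂ, {u : Site 2 | infDist ((δ : ℂ) * ((Real.sqrt 3 : ℂ) *
      (triEmbed u - (1 + triZeta) / 3))) (imagAxisRefl '' T) ≤ 2 * δ} =
      φ '' {u : Site 2 | infDist ((δ : ℂ) * ((Real.sqrt 3 : ℂ) *
        (triEmbed u - (1 + triZeta) / 3))) T ≤ 2 * δ} := by
    intro T; rw [himage]; ext u; simp only [mem_setOf_eq]; rw [infDist_image_imagAxisRefl, hρz]
  unfold embDomainCrossing
  rw [h1, h2 A, h2 B]
  exact bondPercolation_real_image φ p _ _ _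

end Summit.CriticalPhenomena.CardyFormulaZ2.Theorems.BondTriangularCardyLine

end
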